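import Summits.Ventures.Crystal3D.Theorems.StickyWulffConstantTextureLiminfTexShadowLevelReachHexagonBarlowShape
import Summits.Ventures.Crystal3D.Theorems.StickyWulffConstantTextureLiminfTexShadowLevelReachHexagonTop
import Summits.Ventures.Crystal3D.Theorems.StickyWulffConstantCoaxialWallLawEndRowPattern
import Summits.Ventures.Crystal3D.Theorems.StickyWulffConstantCoaxialWallLawEndRowDischarge
import Summits.Ventures.Crystal3D.Theorems.StickyWulffConstantCoaxialWallLawEndRowDefsA
import Summits.Ventures.Crystal3D.Theorems.StickyWulffConstantGenericWallFloorShellCount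
import HarnessLib

/-!
# BOTH plates' cut hexagon censuses POOLED under ONE abstract local row (the two-plate GLOBAL POOLING of the (β) plates side)
# (lane T, crux `TextureLiminfV5`, stmt-Ventures-23912, registered stub `stub_terraceCensus`; cf-p1 (cclxxxvii): «assembly = global pooling, ONE application of the row»)

HONEST FRAMING. Venture `Summits/Ventures/Crystal3D` (cell `crystal3d-full`), route `route-Ventures-StickyWulffConstant`, helper `--supports` the law-v5
crux `TextureLiminfV5` (stmt-Ventures-23912), lane T.  Census-free and certificate-free: the payer-side input is lane F's ABSTRACT local row
`LocalEndRowA ver sF S₁ S₂` BY NAME for the PAIR of plate systems `S₁ = ⟨Fr, inPlaneRoots Fr 1⟩` (bottom plate, rising hexagon roots) and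
`S₂ = ⟨G₂, inPlaneRoots G₂ (−1)⟩` (top plate, falling hexagon roots), any constant `sF`; `KissingGap δ` / `KissingClassification δ` by name.  Nothing about
energies; F-C1 not moved.

THE POINT.  The bottom plate's export `hexagon_barlow_endPairs_cuts_shape` (…LevelReachHexagonBarlowShape) and the top plate's (the same theorem in the
MIRRORED cell `M(X)`, `M p = bM p + h·e₃`, pulled back with lane F's `isEndMove_transport`: the mirrored classes `Fw_{G₂≫bM} κ` conjugate to the classes
`Fw_{G₂} κ` of `S₂`, roots `inPlaneRoots (G₂ ≫ bM) 1 = inPlaneRoots G₂ (−1)`) are two typed end-pair sets `T₁`, `T₂ ⊆ X × X`.  By the SHAPE clause every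
bottom pair is a straight rising ending `q = b − Fr r'`, `(Fr r')₂ > 0`, and every top pair a straight falling one `q = b − G₂ r'`, `(G₂ r')₂ < 0`; so
`T₁ ∩ T₂ = ∅`, every pair of `T₁ ∪ T₂` is an `IsEndPairA` of `(S₁, S₂)`, and ONE application of `card_endPairs_le_of_localRow` gives
**`hexagon_twoPlate_sources_le_payers_cuts`**:
`Σ_{r ∈ RT₁} #src₁(r) + Σ_{r ∈ RT₂} #src₂(r) ≤ sF · Σ_{PAYW} (12 − deg) + Σ CUT₁ + Σ CUT₂ + #RT₁·rims₁ + #RT₂·rims₂` (in `ℝ`), with the source, cut and rim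
terms of …LevelReachHexagonRow (bottom) and …LevelReachHexagonTop (top) verbatim and ONE widened-window payer sum.
WHAT THIS IS NOT: the row (a hypothesis), the flux form and the payer-currency (O(ρ)) form (next file), the born-line families, the certificate; F-C1 not moved.
-/

noncomputable section

namespace Summit.Ventures.Crystal3D.Theorems

open Summit.Ventures.Crystal3D Finset
open Literature.MathematicalPhysics.StatisticalMechanics (barlowPos barlowStacking IsHaggSeq barlowPos_mem basalMirror
  basalMirror_apply_coord basalMirror_basalMirror)
open Summit.Ventures.Crystal3D.Cruxes.TextureLiminf.TexShadow (E3 stacking)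
open scoped InnerProductSpace

/-- The word frames of the mirrored top system `⟨G₂ ≫ bM, RT⟩` conjugate by `bM` to those of `⟨G₂, RT'⟩`. -/
theorem fw_trans_basalMirror_conj (G₂ : E3 ≃ₗᵢ[ℝ] E3) (RT RT' : Finset E3) (κ : List E3) :
    ((⟨G₂.trans basalMirror, RT⟩ : PlateSystem).Fw κ).trans basalMirror = (⟨G₂, RT'⟩ : PlateSystem).Fw κ := by
  induction κ with
  | nil =>
    refine LinearIsometryEquiv.ext fun x => ?_
    show basalMirror ((G₂.trans basalMirror) x) = G₂ x
    rw [LinearIsometryEquiv.trans_apply, basalMirror_basalMirror]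
  | cons μ κ ih =>
    show (((ℝ ∙ μ)ᗮ.reflection).trans ((⟨G₂.trans basalMirror, RT⟩ : PlateSystem).Fw κ)).trans basalMirror =
      ((ℝ ∙ μ)ᗮ.reflection).trans ((⟨G₂, RT'⟩ : PlateSystem).Fw κ)
    rw [← ih]; rfl

set_option maxHeartbeats 400000 in
open scoped Classical in
/-- **Both plates' cut hexagon censuses under ONE local row.**  See the module docstring. -/
theorem hexagon_twoPlate_sources_le_payers_cuts (ver : WordVersion) {δ : ℝ} (hg : KissingGap δ) (hc : KissingClassification δ)
    {σ₁ σ₂ : ℤ → ℤ} (hσ₁ : IsHaggSeq σ₁) (hσ₂ : IsHaggSeq σ₂) (L₁ L₂ : E3 ≃ₗᵢ[ℝ] E3) (s₁ s₂ : E3)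
    (Fr : E3 ≃ₗᵢ[ℝ] E3) {t : ℤ} (hFr : (t = 1 ∧ Fr = L₁) ∨ (t = -1 ∧ Fr = basalMirror.trans L₁))
    (G₂ : E3 ≃ₗᵢ[ℝ] E3) {t' : ℤ} (hG₂ : (t' = 1 ∧ G₂ = L₂) ∨ (t' = -1 ∧ G₂ = basalMirror.trans L₂))
    (hne₁ : (Fr : E3 → E3) '' ↑fccSlots ≠ (L₂ : E3 → E3) '' ↑fccSlots)
    (hne₂ : (Fr : E3 → E3) '' ↑fccSlots ≠ ((basalMirror.trans L₂ : E3 ≃ₗᵢ[ℝ] E3) : E3 → E3) '' ↑fccSlots)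
    (hne₁' : (G₂ : E3 → E3) '' ↑fccSlots ≠ (L₁ : E3 → E3) '' ↑fccSlots)
    (hne₂' : (G₂ : E3 → E3) '' ↑fccSlots ≠ ((basalMirror.trans L₁ : E3 ≃ₗᵢ[ℝ] E3) : E3 → E3) '' ↑fccSlots)
    {sF : ℝ} (hrow : LocalEndRowA ver sF ⟨Fr, inPlaneRoots Fr 1⟩ ⟨G₂, inPlaneRoots G₂ (-1)⟩)
    (X P₁ P₂ : Finset E3) (R₀ h ρ : ℝ) (hR₀ : 5 ≤ R₀) (hρ : R₀ + 2 ≤ ρ)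
    (hX : ∀ p ∈ X, ∀ q ∈ X, p ≠ q → 1 ≤ dist p q) (hP₁X : P₁ ⊆ X) (hP₂X : P₂ ⊆ X)
    (hP₁ : ∀ p, p ∈ P₁ ↔ (p ∈ stacking L₁ s₁ σ₁ ∧ -(2 * R₀) ≤ p 2 ∧ p 2 ≤ -R₀ ∧ p 0 ^ 2 + p 1 ^ 2 ≤ ρ ^ 2))
    (hP₂ : ∀ p, p ∈ P₂ ↔ (p ∈ stacking L₂ s₂ σ₂ ∧ h + R₀ ≤ p 2 ∧ p 2 ≤ h + 2 * R₀ ∧ p 0 ^ 2 + p 1 ^ 2 ≤ ρ ^ 2)) :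
    ((∑ r ∈ inPlaneRoots Fr 1,
        ((P₁.filter fun p => -(R₀ + 1) - 1 - 1 ≤ p 2 ∧ p 2 ≤ -(R₀ + 1) - 1 ∧ p 0 ^ 2 + p 1 ^ 2 ≤ (ρ - 1 - 1) ^ 2).filter
          fun p => (∃ k i j : ℤ, p = L₁ (barlowPos 1 (Real.sqrt (2 / 3)) σ₁ k i j) + s₁ ∧ ¬ (σ₁ (k - 1) = -t ∧ σ₁ k = -t)) ∧
            -(R₀ + 1) - 1 < (p + Fr r) 2 ∧ (p + Fr r) 2 < h + (R₀ + 1) + 1).card : ℕ) : ℝ) +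
      ((∑ r ∈ inPlaneRoots G₂ (-1),
        ((P₂.filter fun p => h + (R₀ + 1) + 1 ≤ p 2 ∧ p 2 ≤ h + (R₀ + 1) + 1 + 1 ∧ p 0 ^ 2 + p 1 ^ 2 ≤ (ρ - 1 - 1) ^ 2).filter
          fun p => (∃ k i j : ℤ, p = L₂ (barlowPos 1 (Real.sqrt (2 / 3)) σ₂ k i j) + s₂ ∧ ¬ (σ₂ (k - 1) = -t' ∧ σ₂ k = -t')) ∧
            -(R₀ + 1) - 1 < (p + G₂ r) 2 ∧ (p + G₂ r) 2 < h + (R₀ + 1) + 1).card : ℕ) : ℝ) ≤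
      sF * ∑ z ∈ X.filter (fun z => (X.filter fun q => dist z q = 1).card ≤ 11 ∧
          -(R₀ + 1) - 2 ≤ z 2 ∧ z 2 ≤ h + (R₀ + 1) + 2), ((12 : ℝ) - ((X.filter fun q => dist z q = 1).card : ℝ)) +
        ((∑ r ∈ inPlaneRoots Fr 1, (X.filter fun b => -(R₀ + 1) - 1 ≤ b 2 ∧ b 2 < h + (R₀ + 1) + 1 ∧
            (∃ μ, ⟪r, μ⟫_ℝ = Real.sqrt (2 / 3) ∧ IsTwinReading X Fr (Fr μ) b) ∧ b - Fr r ∈ X).card : ℕ) : ℝ) +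
        ((∑ r ∈ inPlaneRoots G₂ (-1), (X.filter fun b => -(R₀ + 1) - 1 < b 2 ∧ b 2 ≤ h + (R₀ + 1) + 1 ∧
            (∃ μ, ⟪r, μ⟫_ℝ = Real.sqrt (2 / 3) ∧ IsTwinReading X G₂ (G₂ μ) b) ∧ b - G₂ r ∈ X).card : ℕ) : ℝ) +
        ((inPlaneRoots Fr 1).card : ℝ) *
          (220 * ((X.filter fun s => h + (R₀ + 1) + 1 ≤ s 2 ∧ s 2 ≤ h + (R₀ + 1) + 1 + 1 ∧
              (ρ - 1 - 2) ^ 2 < s 0 ^ 2 + s 1 ^ 2).card : ℝ) +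
            220 * ((X.filter fun s => -(R₀ + 1) - 1 - 1 ≤ s 2 ∧ s 2 < -(R₀ + 1) - 1 ∧
              (ρ - 1 - 1) ^ 2 < s 0 ^ 2 + s 1 ^ 2).card : ℝ)) +
        ((inPlaneRoots G₂ (-1)).card : ℝ) *
          (220 * ((X.filter fun s => -(R₀ + 1) - 1 - 1 ≤ s 2 ∧ s 2 ≤ -(R₀ + 1) - 1 ∧
              (ρ - 1 - 2) ^ 2 < s 0 ^ 2 + s 1 ^ 2).card : ℝ) +
            220 * ((X.filter fun s => h + (R₀ + 1) + 1 < s 2 ∧ s 2 ≤ h + (R₀ + 1) + 1 + 1 ∧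
              (ρ - 1 - 1) ^ 2 < s 0 ^ 2 + s 1 ^ 2).card : ℝ)) := by
  -- the cell mirror (named first, before any census is opened)
  set cM : E3 := h • EuclideanSpace.single (2 : Fin 3) (1 : ℝ) with hcM
  set M : E3 → E3 := fun q => basalMirror q + cM with hM
  set Fr' : E3 ≃ₗᵢ[ℝ] E3 := G₂.trans basalMirror with hFr'
  -- (0) the bottom family
  obtain ⟨T₁, hkey₁, hT₁pair, hT₁pay, hT₁shape, hT₁wit⟩ := hexagon_barlow_endPairs_cuts_shape ver hg hc hσ₁ hσ₂ L₁ L₂ s₁ s₂ Fr hFr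
    hne₁ hne₂ X P₁ P₂ R₀ h ρ hR₀ hρ hX hP₁X hP₂X hP₁ hP₂
  -- (1) the mirrored cell and the top family
  have hMinj : Function.Injective M := mirror_injective h
  have hMM : ∀ p, M (M p) = p := fun p => mirror_mirror h p
  have hM2 : ∀ p, M p 2 = h - p 2 := fun p => mirror_apply_two h p
  have hMlat : ∀ p, M p 0 ^ 2 + M p 1 ^ 2 = p 0 ^ 2 + p 1 ^ 2 := fun p => mirror_lat h p
  have hMdist : ∀ p q, dist (M p) (M q) = dist p q := fun p q => mirror_dist h p q
  have hcardM : ∀ (Y : Finset E3) (p : E3 → Prop) [DecidablePred p],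
      ((Y.image M).filter p).card = (Y.filter fun q => p (M q)).card :=
    fun Y p _ => by rw [filter_image, card_image_of_injective _ hMinj]
  have hmemM : ∀ b v : E3, M b + v ∈ X.image M ↔ b + basalMirror v ∈ X := fun b v => mirror_add_mem_image_iff X h b v
  have hmemX' : ∀ p, p ∈ X.image M ↔ M p ∈ X := fun p => mem_image_mirror_iff h X p
  have hX'' : (X.image M).image M = X := by
    ext p
    rw [mem_image]
    constructor
    · rintro ⟨q, hq, rfl⟩; exact (hmemX' q).1 hq
    · intro hp; exact ⟨M p, (hmemX' _).2 (by rw [hMM]; exact hp), hMM p⟩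
  have hdeg : ∀ x, (X.filter fun q => dist (M x) q = 1).card = ((X.image M).filter fun q => dist x q = 1).card := by
    intro x
    have e := mirrorCell_deg_eq X h (M x)
    rw [show basalMirror (M x) + h • EuclideanSpace.single (2 : Fin 3) (1 : ℝ) = x from hMM x] at e
    exact e.symm
  have hreadM : ∀ (m b : E3), IsTwinReading (X.image M) Fr' (basalMirror m) (M b) ↔ IsTwinReading X G₂ m b :=
    fun m b => isTwinReading_mirror_iff X h G₂ m b
  have hXsep' : ∀ p ∈ X.image M, ∀ q ∈ X.image M, p ≠ q → 1 ≤ dist p q := mirrorCell_separated X hX cM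
  have hP₁'X : P₂.image M ⊆ X.image M := image_subset_image hP₂X
  have hP₂'X : P₁.image M ⊆ X.image M := image_subset_image hP₁X
  have hP₁' : ∀ p, p ∈ P₂.image M ↔ (p ∈ stacking (L₂.trans basalMirror) (M s₂) σ₂ ∧
      -(2 * R₀) ≤ p 2 ∧ p 2 ≤ -R₀ ∧ p 0 ^ 2 + p 1 ^ 2 ≤ ρ ^ 2) := mirrorCell_plate_bottom P₂ L₂ s₂ σ₂ R₀ h ρ hP₂
  have hP₂' : ∀ p, p ∈ P₁.image M ↔ (p ∈ stacking (L₁.trans basalMirror) (M s₁) σ₁ ∧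
      h + R₀ ≤ p 2 ∧ p 2 ≤ h + 2 * R₀ ∧ p 0 ^ 2 + p 1 ^ 2 ≤ ρ ^ 2) := mirrorCell_plate_top P₁ L₁ s₁ σ₁ R₀ h ρ hP₁
  have hFr'cases : (t' = 1 ∧ Fr' = L₂.trans basalMirror) ∨ (t' = -1 ∧ Fr' = basalMirror.trans (L₂.trans basalMirror)) := by
    rcases hG₂ with ⟨ht, hG⟩ | ⟨ht, hG⟩
    · exact Or.inl ⟨ht, by rw [hFr', hG]⟩
    · exact Or.inr ⟨ht, by rw [hFr', hG]; exact LinearIsometryEquiv.ext fun x => rfl⟩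
  have hne₁'' : (Fr' : E3 → E3) '' ↑fccSlots ≠ ((L₁.trans basalMirror : E3 ≃ₗᵢ[ℝ] E3) : E3 → E3) '' ↑fccSlots := by
    rw [hFr', image_slots_trans_basalMirror, image_slots_trans_basalMirror]; exact image_basalMirror_ne hne₁'
  have hne₂'' : (Fr' : E3 → E3) '' ↑fccSlots ≠
      ((basalMirror.trans (L₁.trans basalMirror) : E3 ≃ₗᵢ[ℝ] E3) : E3 → E3) '' ↑fccSlots := by
    have e : basalMirror.trans (L₁.trans basalMirror) = (basalMirror.trans L₁).trans basalMirror :=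
      LinearIsometryEquiv.ext fun x => rfl
    rw [hFr', e, image_slots_trans_basalMirror, image_slots_trans_basalMirror]; exact image_basalMirror_ne hne₂'
  obtain ⟨T₂', hkey₂, hT₂pair', hT₂pay', hT₂shape', hT₂wit'⟩ := hexagon_barlow_endPairs_cuts_shape ver hg hc hσ₂ hσ₁
    (L₂.trans basalMirror) (L₁.trans basalMirror) (M s₂) (M s₁) Fr' hFr'cases hne₁'' hne₂'' (X.image M) (P₂.image M) (P₁.image M)
    R₀ h ρ hR₀ hρ hXsep' hP₁'X hP₂'X hP₁' hP₂'
  -- transports of the counted terms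
  have hRT : inPlaneRoots Fr' 1 = inPlaneRoots G₂ (-1) := inPlaneRoots_trans_basalMirror G₂
  have hFr'2 : ∀ v, (Fr' v) 2 = -(G₂ v) 2 := fun v => trans_basalMirror_apply_two G₂ v
  have hsrc := card_topSources_mirror P₂ L₂ G₂ s₂ σ₂ t' R₀ h ρ
  have hcut : ∀ r, ((X.image M).filter fun b => -(R₀ + 1) - 1 ≤ b 2 ∧ b 2 < h + (R₀ + 1) + 1 ∧
        (∃ μ, ⟪r, μ⟫_ℝ = Real.sqrt (2 / 3) ∧ IsTwinReading (X.image M) Fr' (Fr' μ) b) ∧ b - Fr' r ∈ X.image M).card =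
      (X.filter fun b => -(R₀ + 1) - 1 < b 2 ∧ b 2 ≤ h + (R₀ + 1) + 1 ∧
        (∃ μ, ⟪r, μ⟫_ℝ = Real.sqrt (2 / 3) ∧ IsTwinReading X G₂ (G₂ μ) b) ∧ b - G₂ r ∈ X).card := by
    intro r
    rw [hcardM]
    refine congrArg _ (filter_congr fun b _ => ?_)
    have hread : ∀ μ, IsTwinReading (X.image M) Fr' (Fr' μ) (M b) ↔ IsTwinReading X G₂ (G₂ μ) b := fun μ => by
      have e : Fr' μ = basalMirror (G₂ μ) := by rw [hFr', LinearIsometryEquiv.trans_apply]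
      rw [e]; exact hreadM (G₂ μ) b
    have hpred : M b - Fr' r ∈ X.image M ↔ b - G₂ r ∈ X := by
      rw [sub_eq_add_neg, hmemM, map_neg, hFr', LinearIsometryEquiv.trans_apply, basalMirror_basalMirror, ← sub_eq_add_neg]
    simp only [hread, hpred, hM2]
    constructor
    · rintro ⟨h1, h2, h3, h4⟩; exact ⟨by linarith, by linarith, h3, h4⟩
    · rintro ⟨h1, h2, h3, h4⟩; exact ⟨by linarith, by linarith, h3, h4⟩
  have hrimT : ((X.image M).filter fun s => h + (R₀ + 1) + 1 ≤ s 2 ∧ s 2 ≤ h + (R₀ + 1) + 1 + 1 ∧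
        (ρ - 1 - 2) ^ 2 < s 0 ^ 2 + s 1 ^ 2).card =
      (X.filter fun s => -(R₀ + 1) - 1 - 1 ≤ s 2 ∧ s 2 ≤ -(R₀ + 1) - 1 ∧ (ρ - 1 - 2) ^ 2 < s 0 ^ 2 + s 1 ^ 2).card := by
    rw [hcardM]
    refine congrArg _ (filter_congr fun s _ => ?_)
    simp only [hM2, hMlat]
    constructor
    · rintro ⟨h1, h2, h3⟩; exact ⟨by linarith, by linarith, h3⟩
    · rintro ⟨h1, h2, h3⟩; exact ⟨by linarith, by linarith, h3⟩
  have hrimB : ((X.image M).filter fun s => -(R₀ + 1) - 1 - 1 ≤ s 2 ∧ s 2 < -(R₀ + 1) - 1 ∧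
        (ρ - 1 - 1) ^ 2 < s 0 ^ 2 + s 1 ^ 2).card =
      (X.filter fun s => h + (R₀ + 1) + 1 < s 2 ∧ s 2 ≤ h + (R₀ + 1) + 1 + 1 ∧ (ρ - 1 - 1) ^ 2 < s 0 ^ 2 + s 1 ^ 2).card := by
    rw [hcardM]
    refine congrArg _ (filter_congr fun s _ => ?_)
    simp only [hM2, hMlat]
    constructor
    · rintro ⟨h1, h2, h3⟩; exact ⟨by linarith, by linarith, h3⟩
    · rintro ⟨h1, h2, h3⟩; exact ⟨by linarith, by linarith, h3⟩
  rw [hRT, sum_congr rfl fun r _ => hsrc r, sum_congr rfl fun r _ => hcut r, hrimT, hrimB] at hkey₂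
  -- (2) pull the top family back to `X`
  set S₁ : PlateSystem := ⟨Fr, inPlaneRoots Fr 1⟩ with hS₁
  set S₂ : PlateSystem := ⟨G₂, inPlaneRoots G₂ (-1)⟩ with hS₂
  set S' : PlateSystem := ⟨Fr', inPlaneRoots Fr' 1⟩ with hS'
  have hconv : ∀ κ : List E3, (S'.Fw κ).trans basalMirror = S₂.Fw κ := fun κ => by
    rw [hS', hS₂, hFr']; exact fw_trans_basalMirror_conj G₂ _ _ κ
  set T₂ : Finset (E3 × E3) := T₂'.image (fun bq => (M bq.1, M bq.2)) with hT₂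
  have hPinj : Function.Injective (fun bq : E3 × E3 => (M bq.1, M bq.2)) := by
    intro a b hab
    simp only [Prod.mk.injEq] at hab
    exact Prod.ext (hMinj hab.1) (hMinj hab.2)
  have hT₂card : T₂.card = T₂'.card := card_image_of_injective _ hPinj
  have hT₂pair : ∀ bq ∈ T₂, bq.1 ∈ X ∧ bq.2 ∈ X ∧ dist bq.1 bq.2 = 1 ∧ -(R₀ + 1) - 1 < bq.1 2 ∧ bq.1 2 ≤ h + (R₀ + 1) + 1 := by
    intro bq hbq
    obtain ⟨bq', hbq', rfl⟩ := mem_image.1 hbq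
    obtain ⟨h1, h2, h3, h4, h5⟩ := hT₂pair' bq' hbq'
    refine ⟨(hmemX' _).1 h1, (hmemX' _).1 h2, by rw [hMdist]; exact h3, ?_, ?_⟩
    · show -(R₀ + 1) - 1 < M bq'.1 2; rw [hM2]; linarith
    · show M bq'.1 2 ≤ h + (R₀ + 1) + 1; rw [hM2]; linarith
  have hT₂pay : ∀ bq ∈ T₂, (X.filter fun q => dist bq.1 q = 1).card ≤ 11 ∨
      ∃ z₁ ∈ X, ∃ z₂ ∈ X, z₁ ≠ z₂ ∧ dist bq.1 z₁ = 1 ∧ dist bq.1 z₂ = 1 ∧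
        (X.filter fun q => dist z₁ q = 1).card ≤ 11 ∧ (X.filter fun q => dist z₂ q = 1).card ≤ 11 := by
    intro bq hbq
    obtain ⟨bq', hbq', rfl⟩ := mem_image.1 hbq
    rcases hT₂pay' bq' hbq' with h11 | ⟨z₁, hz₁, z₂, hz₂, hne, hd₁, hd₂, hc₁, hc₂⟩
    · left; show (X.filter fun q => dist (M bq'.1) q = 1).card ≤ 11; rw [hdeg]; exact h11
    · right
      refine ⟨M z₁, (hmemX' _).1 hz₁, M z₂, (hmemX' _).1 hz₂, fun h' => hne (hMinj h'), ?_, ?_, ?_, ?_⟩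
      · show dist (M bq'.1) (M z₁) = 1; rw [hMdist]; exact hd₁
      · show dist (M bq'.1) (M z₂) = 1; rw [hMdist]; exact hd₂
      · rw [hdeg]; exact hc₁
      · rw [hdeg]; exact hc₂
  have hT₂shape : ∀ bq ∈ T₂, ∃ r' ∈ inPlaneRoots G₂ (-1), bq.2 = bq.1 - G₂ r' := by
    intro bq hbq
    obtain ⟨bq', hbq', rfl⟩ := mem_image.1 hbq
    obtain ⟨r', hr', hshape, -⟩ := hT₂shape' bq' hbq'
    rw [hRT] at hr'
    refine ⟨r', hr', ?_⟩
    show M bq'.2 = M bq'.1 - G₂ r'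
    rw [hshape]
    simp only [hM, map_sub, hFr', LinearIsometryEquiv.trans_apply, basalMirror_basalMirror]
    abel
  have hT₂adm : ∀ bq ∈ T₂, ∃ (G' : E3 ≃ₗᵢ[ℝ] E3) (d' : E3), S₂.Adm G' d' ∧ bq.2 - d' ∈ X ∧ IsEndMove X ver G' d' bq.2 bq.1 := by
    intro bq hbq
    obtain ⟨bq', hbq', rfl⟩ := mem_image.1 hbq
    obtain ⟨r, hr, κ, hWF, hpred, hmove⟩ := hT₂wit' bq' hbq'
    have hmoveX := isEndMove_transport (X' := X.image M) basalMirror cM hmove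
    rw [hX'', hconv κ] at hmoveX
    set d : E3 := S'.Fw κ (((-1 : ℝ) ^ κ.length) • r) with hd
    have hd₂ : basalMirror d = S₂.Fw κ (((-1 : ℝ) ^ κ.length) • r) := by rw [hd, ← hconv κ]; rfl
    refine ⟨S₂.Fw κ, S₂.Fw κ (((-1 : ℝ) ^ κ.length) • r),
      ⟨r, by show r ∈ inPlaneRoots G₂ (-1); rw [← hRT]; exact hr, κ, hWF, rfl, rfl⟩, ?_, ?_⟩
    · have := (hmemX' _).1 hpred
      have e : M (bq'.2 - d) = M bq'.2 - basalMirror d := by simp only [hM, map_sub]; abel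
      rw [e, hd₂] at this
      exact this
    · rw [← hd₂]; exact hmoveX
  -- (3) the two families are DISJOINT: rising vs falling straight endings
  have hdisj : Disjoint T₁ T₂ := by
    rw [Finset.disjoint_left]
    intro bq h₁ h₂
    obtain ⟨r₁, hr₁, hs₁, -⟩ := hT₁shape bq h₁
    obtain ⟨r₂, hr₂, hs₂⟩ := hT₂shape bq h₂
    have hup : 0 < (Fr r₁) 2 := by have := (mem_filter.1 hr₁).2.2; linarith
    have hdn : (G₂ r₂) 2 < 0 := by have := (mem_filter.1 hr₂).2.2; linarith
    have e1 : bq.2 2 = bq.1 2 - (Fr r₁) 2 := by rw [hs₁]; rfl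
    have e2 : bq.2 2 = bq.1 2 - (G₂ r₂) 2 := by rw [hs₂]; rfl
    linarith
  -- (4) ONE application of the local row to `T₁ ∪ T₂`
  set T := T₁ ∪ T₂ with hT
  have hTcard : T.card = T₁.card + T₂'.card := by rw [hT, card_union_of_disjoint hdisj, hT₂card]
  have hEP : ∀ bq ∈ T, IsEndPairA X ver S₁ S₂ bq.1 bq.2 := by
    intro bq hbq
    rcases mem_union.1 hbq with h₁ | h₂
    · obtain ⟨hb, hq, -, -, -⟩ := hT₁pair bq h₁
      obtain ⟨r, hr, κ, hWF, hpred, hmove⟩ := hT₁wit bq h₁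
      exact ⟨hq, hb, hT₁pay bq h₁, S₁.Fw κ, S₁.Fw κ (((-1 : ℝ) ^ κ.length) • r), Or.inl ⟨r, hr, κ, hWF, rfl, rfl⟩,
        hpred, hmove⟩
    · obtain ⟨hb, hq, -, -, -⟩ := hT₂pair bq h₂
      obtain ⟨G', d', hadm, hpred, hmove⟩ := hT₂adm bq h₂
      exact ⟨hq, hb, hT₂pay bq h₂, G', d', Or.inr hadm, hpred, hmove⟩
  set PAYW := X.filter (fun z => (X.filter fun q => dist z q = 1).card ≤ 11 ∧
    -(R₀ + 1) - 2 ≤ z 2 ∧ z 2 ≤ h + (R₀ + 1) + 2) with hPAYW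
  have hTX : ∀ bq ∈ T, bq.1 ∈ X := fun bq hbq => by
    rcases mem_union.1 hbq with h₁ | h₂
    · exact (hT₁pair bq h₁).1
    · exact (hT₂pair bq h₂).1
  have hwin : ∀ bq ∈ T, -(R₀ + 1) - 1 ≤ bq.1 2 ∧ bq.1 2 ≤ h + (R₀ + 1) + 1 := by
    intro bq hbq
    rcases mem_union.1 hbq with h₁ | h₂
    · obtain ⟨-, -, -, h4, h5⟩ := hT₁pair bq h₁; exact ⟨h4, h5.le⟩
    · obtain ⟨-, -, -, h4, h5⟩ := hT₂pair bq h₂; exact ⟨h4.le, h5⟩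
  have hpayT : ∀ bq ∈ T, (X.filter fun q => dist bq.1 q = 1).card ≤ 11 ∨
      ∃ z₁ ∈ X, ∃ z₂ ∈ X, z₁ ≠ z₂ ∧ dist bq.1 z₁ = 1 ∧ dist bq.1 z₂ = 1 ∧
        (X.filter fun q => dist z₁ q = 1).card ≤ 11 ∧ (X.filter fun q => dist z₂ q = 1).card ≤ 11 := fun bq hbq => by
    rcases mem_union.1 hbq with h₁ | h₂
    · exact hT₁pay bq h₁
    · exact hT₂pay bq h₂
  have hclosed : ∀ bq ∈ T, ∀ z ∈ X, dist bq.1 z ≤ 1 → (X.filter fun q => dist z q = 1).card ≤ 11 → z ∈ PAYW := by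
    intro bq hbq z hzX hdz hz11
    obtain ⟨h4, h5⟩ := hwin bq hbq
    have h2 : (z 2 - bq.1 2) ^ 2 ≤ 1 := by
      have := sq_sub_apply_le_dist_sq z bq.1 2
      rw [dist_comm] at hdz; nlinarith [this, hdz, dist_nonneg (x := z) (y := bq.1)]
    have h2' : |z 2 - bq.1 2| ≤ 1 := by rw [← sq_le_one_iff_abs_le_one]; exact h2
    obtain ⟨ha, hb⟩ := abs_le.1 h2'
    exact mem_filter.2 ⟨hzX, hz11, by linarith, by linarith⟩
  have hpay : ∀ bq ∈ T, ∃ z ∈ X, dist bq.1 z ≤ 1 ∧ (X.filter fun q => dist z q = 1).card ≤ 11 := by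
    intro bq hbq
    rcases hpayT bq hbq with h11 | ⟨z₁, hz₁, -, -, -, hd₁, -, hc₁, -⟩
    · exact ⟨bq.1, hTX bq hbq, by rw [dist_self]; norm_num, h11⟩
    · exact ⟨z₁, hz₁, hd₁.le, hc₁⟩
  have hmult : ∀ b, ((T.filter fun bq => bq.1 = b).card : ℝ) ≤ (endMultA X ver S₁ S₂ b : ℝ) := by
    intro b
    have : (T.filter fun bq => bq.1 = b).card ≤ (X.filter fun q => IsEndPairA X ver S₁ S₂ b q).card := by
      refine card_le_card_of_injOn (fun bq => bq.2) (fun bq hbq => ?_) ?_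
      · obtain ⟨hbqT, hb1⟩ := mem_filter.1 hbq
        have hep := hEP bq hbqT
        rw [hb1] at hep
        exact mem_coe.2 (mem_filter.2 ⟨hep.1, hep⟩)
      · intro bq hbq bq' hbq' heq
        obtain ⟨-, hb⟩ := mem_filter.1 (mem_coe.1 hbq)
        obtain ⟨-, hb'⟩ := mem_filter.1 (mem_coe.1 hbq')
        exact Prod.ext (hb.trans hb'.symm) heq
    exact_mod_cast this
  have hDnn : ∀ b, 0 ≤ pooledDef X b := by
    intro b
    refine sum_nonneg fun z hz => ?_
    have : ((X.filter fun q => dist z q = 1).card : ℝ) ≤ 11 := by exact_mod_cast (mem_filter.1 hz).2.2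
    linarith
  have hrow' : ∀ z ∈ PAYW,
      ∑ b ∈ X.filter (fun b => dist z b ≤ 1 ∧ 0 < (T.filter fun bq => bq.1 = b).card),
        ((T.filter fun bq => bq.1 = b).card : ℝ) /
          (∑ z' ∈ X.filter (fun z' => dist b z' ≤ 1 ∧ (X.filter fun q => dist z' q = 1).card ≤ 11),
            ((12 : ℝ) - ((X.filter fun q => dist z' q = 1).card : ℝ))) ≤ sF := by
    intro z hz
    obtain ⟨hzX, hz11, -, -⟩ := mem_filter.1 hz
    have key := hrow X hX z hzX hz11
    refine le_trans ?_ key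
    calc ∑ b ∈ X.filter (fun b => dist z b ≤ 1 ∧ 0 < (T.filter fun bq => bq.1 = b).card),
          ((T.filter fun bq => bq.1 = b).card : ℝ) / pooledDef X b
        ≤ ∑ b ∈ X.filter (fun b => dist z b ≤ 1 ∧ 0 < (T.filter fun bq => bq.1 = b).card),
          (endMultA X ver S₁ S₂ b : ℝ) / pooledDef X b :=
          sum_le_sum fun b _ => div_le_div_of_nonneg_right (hmult b) (hDnn b)
      _ ≤ ∑ b ∈ X.filter (fun b => dist z b ≤ 1 ∧ 0 < endMultA X ver S₁ S₂ b),
          (endMultA X ver S₁ S₂ b : ℝ) / pooledDef X b := by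
          refine sum_le_sum_of_subset_of_nonneg (fun b hb => ?_) fun b _ _ =>
            div_nonneg (Nat.cast_nonneg _) (hDnn b)
          obtain ⟨hbX, hd, hpos⟩ := mem_filter.1 hb
          refine mem_filter.2 ⟨hbX, hd, ?_⟩
          have := hmult b
          have hpos' : (0 : ℝ) < (T.filter fun bq => bq.1 = b).card := by exact_mod_cast hpos
          exact_mod_cast (show (0 : ℝ) < endMultA X ver S₁ S₂ b by linarith)
  have key := card_endPairs_le_of_localRow T PAYW hTX (fun z hz => ⟨(mem_filter.1 hz).1, (mem_filter.1 hz).2.1⟩)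
    hclosed hpay hrow'
  -- (5) assemble
  rw [hTcard] at key
  push_cast at key
  have hk₁ := (Nat.cast_le (α := ℝ)).2 hkey₁
  have hk₂ := (Nat.cast_le (α := ℝ)).2 hkey₂
  push_cast at hk₁ hk₂ ⊢
  linarith only [hk₁, hk₂, key]

end Summit.Ventures.Crystal3D.Theorems

end
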